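import Summits.ABC.IUTFork.Repair.CandInternal2RealLabels
import Literature.IUT.LogVolume.UnitLogWildDepth
import HarnessLib

/-!
# IUT REPAIR BRANCH (rung LADDER-ABC:A2.RP → A2.RESCUE-H), class (i) INTERNAL — `CandInternal2RealSharp`: the SHARP UPPER EDGE of the
# I06⋆ label window at the real log-shell, `q ∈ qⁿ·ℐ_K ⟹ (n−1)·h ≤ c + a₀ − p^{a₀}/e` (turning point `a₀`), by integer arithmetic

PROOF-ONLY file (0 definitions, 0 `Prop` facts) of the abc-iut cell, IUT REPAIR branch, D-0079 RESCUE sub-cell R-H («local-height condition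
I06⋆», lead abc-iut-rh-lead; `plan/rescue/R-H/START-HERE.md` v1 §1); seat abc-iut-rp-x2 gen 4 (B ruling R44; R-H uniform lemma
«SHARP-UPPER-EDGE», STATUS 15:15:42Z). TAKES NO SIDE on [IUTchIII] Cor. 3.12 or on any author; classical `p`-adic analysis; standard axioms.

WHAT. The R-H cell verdict (START-HERE §1) reads the content of RP-I06⋆ («`q̲ ∈ q̲^{j²}·ℐ_w`», `ℐ_w = (p*)⁻¹·log_p(𝒪^×_{K_w})`) through
the TWO-SIDED WINDOW of abc-iut-rp-d2's `CandInternal2RealLabels` (p450037 ✓): with `‖q‖ = p^{−h}`, `c = ord_p(p*) ∈ {1, 2}`,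
`e = absRamificationIdx`, `a_e = logRadiusA p e`, `b_e = logRadiusB p e` ([IUTchIV] Prop. 1.2 (i)),
`(n−1)·h ≤ c − a_e ⟹ q ∈ qⁿ·ℐ_K ⟹ (n−1)·h ≤ κ⁺ := b_e + c`. The NECESSARY edge there comes from print's upper inclusion
`log_p(𝒪_K^×) ⊆ p^{−b_e}·𝒪_K`, which is NOT sharp once `e ≥ p − 1` (e.g. `e = p − 1`: `b_e = 1 − 1/e` although `log_p(𝒪_K^×) ⊆ 𝔪_K`,
abc-iut-w5-d172's `UnitLogIntoMaximalIdeal`). The tree already holds the SHARP sup-norm of log-units (abc-iut-w5 lineage,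
`Literature.IUT.LogVolume.RamificationCriterion.norm_le_zpow_of_mem_logUnits`, `UnitLogWildDepth.lean`): for every `z ∈ log_p(𝒪_K^×)`,
`‖z‖ ≤ ‖ϖ‖^{N₀}` with `N₀ = p^{a₀} − e·a₀ = min_a (pᵃ − e·a)`, `a₀` the TURNING POINT (`pᵃ(p−1) < e` for `a < a₀`, `e ≤ p^{a₀}(p−1)`).
This file WIRES that bound into the cell predicate:

* §1 `logShell_subset_closedBall_sharp`: `ℐ_K ⊆ closedBall 0 (‖p*‖⁻¹·p^{−(p^{a₀}/e − a₀)})`.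
* §2 **`height_le_of_mem_pow_smul_logShell_sharp`**: `q ∈ qⁿ·ℐ_K ⟹ (n−1)·h ≤ κ⁺♯ := c + a₀ − p^{a₀}/e`; `not_mem_of_lt_sharp` (the DECIDED-NEG
  cell test `κ⁺♯ < (n−1)·h ⟹ q ∉ qⁿ·ℐ_K`); root form `root_height_le_of_mem_pow_smul_logShell_sharp` (`‖q̲‖^N = p^{−H}`:
  `(n−1)·H ≤ N·κ⁺♯`), `not_mem_root_of_lt_sharp`.
* §3 INTEGER WINDOWS (no turning-point bookkeeping left to the user): `height_le_sharp_of_window` — for `k ≥ 1` with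
  `p^{k−1}(p−1) < e ≤ p^k(p−1)`: `(n−1)·h ≤ c + k − p^k/e`; `height_le_sharp_of_le_sub_one` — for `e ≤ p − 1`: `(n−1)·h ≤ c − 1/e`
  (so at the BOUNDARY stratum `e = p − 1` the necessary edge drops from `c + 1 − 1/e` to `c − 1/e`); the matching `not_mem_…` tests.
* §4 `sharp_le_print`: `κ⁺♯ ≤ κ⁺` always (`a₀ ≤ ⌊log_p(p·e/(p−1))⌋` and `p^{a₀} ≥ 1`) — the sharp test never loses a NEG cell; the gain is
  `(p^{a₀} − 1)/e`, e.g. `(p, e) = (5, 7)`: `κ⁺ = 13/7 ↦ κ⁺♯ = 9/7`; `(3, 10)`: `29/10 ↦ 21/10`; `e = p − 1`: `2 − 1/e ↦ 1 − 1/e` (odd `p`).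
In abc-iut-rp-d2's U-SHAPE notation (STATUS 15:21:27Z: `Λ = log_p(𝒪_K^×) ⊆ 𝔪_K^{B(K)}`, `B(K)` the OUTER exponent in `K`-normalised
integers, known there only as `B(K) ≥ −e·b_e = 1 − e·k`): §1 says **`B(K) ≥ N₀ = p^k − e·k`** on the window `p^{k−1}(p−1) < e ≤ p^k(p−1)`
(gain `p^k − 1`), and `B(K) ≥ 1` for `e ≤ p − 1`.
READING FOR THE TABLE (neutral): in `plan/rescue/R-H/I06STAR-COLUMNS.tsv` the column `kappa_plus` may carry `κ⁺♯ = c + k − p^k/e`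
(`k` from the window `p^{k−1}(p−1) < e ≤ p^k(p−1)`, `k := 0` i.e. `κ⁺♯ = c − 1/e` when `e ≤ p − 1`); cells with `κ⁺♯ < h ≤ κ⁺` move from
OPEN-shape to DECIDED-NEG. The LOWER edge `c − a_e` is untouched (it is print's lower inclusion, sharp in the tame range). Nothing here is a
verdict on any author's reading. [cite: MochizukiAbsTopIII2015, Def 5.4 (iii) p. 126] [cite: NeukirchANT1999, Ch. II (5.5)]
[claim: Mochizuki2012, status: disputed] for the quoted readings of RP-I06⋆.
-/

noncomputable section

namespace Summit.ABC.IUTFork.Repair.CandInternal2RealSharp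

open Set Metric
open scoped Pointwise
open Literature.AnabelianGeometry.AbsoluteAnabelian Literature.IUT.LogThetaLattice Literature.IUT.LogVolume
  Literature.IUT.LogVolume.RamificationCriterion Literature.NumberTheory.GaloisRepresentations.Ultrametric
  Summit.ABC.IUTFork.Repair.CandInternal2Real Summit.ABC.IUTFork.Repair.CandInternal2RealLabels

variable (p : ℕ) [Fact p.Prime]
variable (K : Type*) [NontriviallyNormedField K] [NormedAlgebra ℚ_[p] K] [IsUltrametricDist K] [ProperSpace K]

/-! ## §1. The sharp outer ball of the real log-shell -/

/-- **SHARP sup-norm of log-units as a real power**: at the turning point `a₀` (`pᵃ(p−1) < e` for `a < a₀`, `e ≤ p^{a₀}(p−1)`), every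
`z ∈ log_p(𝒪_K^×)` has `‖z‖ ≤ p^{−(p^{a₀}/e − a₀)}` (abc-iut-w5's `norm_le_zpow_of_mem_logUnits` at the chosen norm uniformizer, rewritten by
`norm_unif_zpow_eq_rpow`). [cite: NeukirchANT1999, Ch. II (5.5)] -/
theorem norm_le_rpow_sharp_of_mem_logUnits {a₀ : ℕ}
    (hlo : ∀ a < a₀, (1 : ℤ) * (p : ℤ) ^ a * ((p : ℤ) - 1) < absRamificationIdx p K)
    (hhi : (absRamificationIdx p K : ℤ) ≤ 1 * (p : ℤ) ^ a₀ * ((p : ℤ) - 1)) {z : K} (hz : z ∈ logUnits K) :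
    ‖z‖ ≤ (p : ℝ) ^ (-((p : ℝ) ^ a₀ / (absRamificationIdx p K : ℝ) - a₀)) := by
  have h := norm_le_zpow_of_mem_logUnits p (isUniformizer_unifChoice K) hlo hhi hz
  rw [norm_unif_zpow_eq_rpow p (isUniformizer_unifChoice K)] at h
  have he : (absRamificationIdx p K : ℝ) ≠ 0 := by exact_mod_cast (absRamificationIdx_pos p K).ne'
  convert h using 2
  push_cast
  field_simp

/-- **SHARP OUTER RADIUS OF THE REAL LOG-SHELL**: `ℐ_K = (p*)⁻¹·log_p(𝒪_K^×) ⊆ closedBall 0 (‖p*‖⁻¹ · p^{−(p^{a₀}/e − a₀)})` at the turning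
point `a₀`. [cite: MochizukiAbsTopIII2015, Def 5.4 (iii) p. 126] [cite: NeukirchANT1999, Ch. II (5.5)] -/
theorem logShell_subset_closedBall_sharp {a₀ : ℕ}
    (hlo : ∀ a < a₀, (1 : ℤ) * (p : ℤ) ^ a * ((p : ℤ) - 1) < absRamificationIdx p K)
    (hhi : (absRamificationIdx p K : ℤ) ≤ 1 * (p : ℤ) ^ a₀ * ((p : ℤ) - 1)) :
    logShell (PadicLogOnUnits.ofUnitLog p K) ⊆
      closedBall (0 : K) (‖((p ^ (if p = 2 then 2 else 1) : ℕ) : K)‖⁻¹ *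
        (p : ℝ) ^ (-((p : ℝ) ^ a₀ / (absRamificationIdx p K : ℝ) - a₀))) := by
  rw [logShell_ofUnitLog]
  rintro _ ⟨y, hy, rfl⟩
  have hyb := norm_le_rpow_sharp_of_mem_logUnits p K hlo hhi hy
  rw [mem_closedBall, dist_zero_right]
  show ‖((p ^ (if p = 2 then 2 else 1) : ℕ) : K)⁻¹ • y‖ ≤ _
  rw [smul_eq_mul, norm_mul, norm_inv]
  exact mul_le_mul_of_nonneg_left hyb (inv_nonneg.2 (norm_nonneg _))

/-! ## §2. The sharp necessary edge of the label window -/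

/-- **SHARP NECESSARY EDGE**: if `q ∈ qⁿ·ℐ_K` and `‖q‖ = p^{−h}`, then `(n−1)·h ≤ κ⁺♯ := c + a₀ − p^{a₀}/e` (`c = ord_p(p*)`, `a₀` the
turning point). Compare `CandInternal2RealLabels.height_le_of_mem_pow_smul_logShell` (`≤ b_e + c`). [cite: MochizukiAbsTopIII2015, Def 5.4 (iii) p. 126]
[claim: Mochizuki2012, status: disputed] -/
theorem height_le_of_mem_pow_smul_logShell_sharp {a₀ : ℕ}
    (hlo : ∀ a < a₀, (1 : ℤ) * (p : ℤ) ^ a * ((p : ℤ) - 1) < absRamificationIdx p K)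
    (hhi : (absRamificationIdx p K : ℤ) ≤ 1 * (p : ℤ) ^ a₀ * ((p : ℤ) - 1))
    {q : K} {h : ℝ} (hqh : ‖q‖ = (p : ℝ) ^ (-h)) {n : ℕ} (hmem : q ∈ q ^ n • logShell (PadicLogOnUnits.ofUnitLog p K)) :
    ((n : ℝ) - 1) * h ≤ ((if p = 2 then 2 else 1 : ℕ) : ℝ) + a₀ - (p : ℝ) ^ a₀ / (absRamificationIdx p K : ℝ) := by
  have hle := norm_le_of_mem_pow_smul (logShell_subset_closedBall_sharp p K hlo hhi) hmem
  have hp1 : (1 : ℝ) < p := by exact_mod_cast (Fact.out : p.Prime).one_lt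
  have hp0 : (0 : ℝ) < p := by linarith
  rw [norm_pstar_inv_eq_rpow p K, hqh, ← Real.rpow_natCast, ← Real.rpow_mul hp0.le, ← Real.rpow_add hp0, ← Real.rpow_add hp0,
    Real.rpow_le_rpow_left_iff hp1] at hle
  linarith

/-- **DECIDED-NEG CELL TEST (sharp)**: `κ⁺♯ < (n−1)·h ⟹ q ∉ qⁿ·ℐ_K`. [claim: Mochizuki2012, status: disputed] -/
theorem not_mem_of_lt_sharp {a₀ : ℕ}
    (hlo : ∀ a < a₀, (1 : ℤ) * (p : ℤ) ^ a * ((p : ℤ) - 1) < absRamificationIdx p K)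
    (hhi : (absRamificationIdx p K : ℤ) ≤ 1 * (p : ℤ) ^ a₀ * ((p : ℤ) - 1))
    {q : K} {h : ℝ} (hqh : ‖q‖ = (p : ℝ) ^ (-h)) {n : ℕ}
    (hlt : ((if p = 2 then 2 else 1 : ℕ) : ℝ) + a₀ - (p : ℝ) ^ a₀ / (absRamificationIdx p K : ℝ) < ((n : ℝ) - 1) * h) :
    q ∉ q ^ n • logShell (PadicLogOnUnits.ofUnitLog p K) :=
  fun hmem => (not_le.2 hlt) (height_le_of_mem_pow_smul_logShell_sharp p K hlo hhi hqh hmem)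

/-- **ROOT FORM of the sharp edge** (the intended Kummer datum is a `2l`-th root: `‖q̲‖^N = p^{−H}`, `N = 2l`, `H = ord_p(q_E)`):
`q̲ ∈ q̲ⁿ·ℐ_K ⟹ (n−1)·H ≤ N·κ⁺♯`. [claim: Mochizuki2012, status: disputed] -/
theorem root_height_le_of_mem_pow_smul_logShell_sharp {a₀ : ℕ}
    (hlo : ∀ a < a₀, (1 : ℤ) * (p : ℤ) ^ a * ((p : ℤ) - 1) < absRamificationIdx p K)
    (hhi : (absRamificationIdx p K : ℤ) ≤ 1 * (p : ℤ) ^ a₀ * ((p : ℤ) - 1))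
    {q : K} {N : ℕ} (hN : 0 < N) {H : ℝ} (hqN : ‖q‖ ^ N = (p : ℝ) ^ (-H)) {n : ℕ}
    (hmem : q ∈ q ^ n • logShell (PadicLogOnUnits.ofUnitLog p K)) :
    ((n : ℝ) - 1) * H ≤ N * (((if p = 2 then 2 else 1 : ℕ) : ℝ) + a₀ - (p : ℝ) ^ a₀ / (absRamificationIdx p K : ℝ)) := by
  have h1 := height_le_of_mem_pow_smul_logShell_sharp p K hlo hhi (norm_eq_rpow_of_pow_eq p (Nat.pos_iff_ne_zero.1 hN) hqN) hmem
  have hN' : (0 : ℝ) < N := by exact_mod_cast hN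
  rw [← mul_div_assoc, div_le_iff₀ hN'] at h1
  linarith

/-- **DECIDED-NEG CELL TEST, root form (sharp)**: `N·κ⁺♯ < (n−1)·H ⟹ q̲ ∉ q̲ⁿ·ℐ_K`. [claim: Mochizuki2012, status: disputed] -/
theorem not_mem_root_of_lt_sharp {a₀ : ℕ}
    (hlo : ∀ a < a₀, (1 : ℤ) * (p : ℤ) ^ a * ((p : ℤ) - 1) < absRamificationIdx p K)
    (hhi : (absRamificationIdx p K : ℤ) ≤ 1 * (p : ℤ) ^ a₀ * ((p : ℤ) - 1))
    {q : K} {N : ℕ} (hN : 0 < N) {H : ℝ} (hqN : ‖q‖ ^ N = (p : ℝ) ^ (-H)) {n : ℕ}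
    (hlt : (N : ℝ) * (((if p = 2 then 2 else 1 : ℕ) : ℝ) + a₀ - (p : ℝ) ^ a₀ / (absRamificationIdx p K : ℝ)) < ((n : ℝ) - 1) * H) :
    q ∉ q ^ n • logShell (PadicLogOnUnits.ofUnitLog p K) :=
  fun hmem => (not_le.2 hlt) (root_height_le_of_mem_pow_smul_logShell_sharp p K hlo hhi hN hqN hmem)

/-! ## §3. The turning point by integer windows -/

/-- **Turning point from an integer window**: for `k ≥ 1` with `p^{k−1}(p−1) < e ≤ p^k(p−1)`, `a₀ = k` is the turning point of
`h(a) = pᵃ − e·a` (for `a < k`, `pᵃ(p−1) ≤ p^{k−1}(p−1) < e`). [cite: NeukirchANT1999, Ch. II (5.5)] -/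
theorem turning_of_window {e k : ℕ} (hk : 1 ≤ k) (hlo : p ^ (k - 1) * (p - 1) < e) (hhi : e ≤ p ^ k * (p - 1)) :
    (∀ a < k, (1 : ℤ) * (p : ℤ) ^ a * ((p : ℤ) - 1) < e) ∧ ((e : ℤ) ≤ 1 * (p : ℤ) ^ k * ((p : ℤ) - 1)) := by
  have hp := (Fact.out : p.Prime).one_lt
  constructor
  · intro a ha
    have hpow : p ^ a ≤ p ^ (k - 1) := Nat.pow_le_pow_right (by omega) (by omega)
    have hle : p ^ a * (p - 1) ≤ p ^ (k - 1) * (p - 1) := Nat.mul_le_mul_right _ hpow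
    have hlt : p ^ a * (p - 1) < e := lt_of_le_of_lt hle hlo
    have hcast : ((p ^ a * (p - 1) : ℕ) : ℤ) < (e : ℤ) := by exact_mod_cast hlt
    rw [Nat.cast_mul, Nat.cast_pow, Nat.cast_sub hp.le, Nat.cast_one] at hcast
    linarith
  · have hcast : ((e : ℕ) : ℤ) ≤ ((p ^ k * (p - 1) : ℕ) : ℤ) := by exact_mod_cast hhi
    rw [Nat.cast_mul, Nat.cast_pow, Nat.cast_sub hp.le, Nat.cast_one] at hcast
    linarith

/-- **Turning point `a₀ = 0` for `e ≤ p − 1`** (all of the tame range, the boundary `e = p − 1`, and `p = 2, e = 1`).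
[cite: NeukirchANT1999, Ch. II (5.5)] -/
theorem turning_zero_of_le {e : ℕ} (he : e ≤ p - 1) :
    (∀ a < 0, (1 : ℤ) * (p : ℤ) ^ a * ((p : ℤ) - 1) < e) ∧ ((e : ℤ) ≤ 1 * (p : ℤ) ^ 0 * ((p : ℤ) - 1)) := by
  have hp := (Fact.out : p.Prime).one_lt
  refine ⟨fun a ha => absurd ha (Nat.not_lt_zero a), ?_⟩
  have hcast : ((e : ℕ) : ℤ) ≤ ((p - 1 : ℕ) : ℤ) := by exact_mod_cast he
  rw [Nat.cast_sub hp.le, Nat.cast_one] at hcast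
  simpa using hcast

/-- **SHARP EDGE BY INTEGER WINDOW**: `k ≥ 1`, `p^{k−1}(p−1) < e ≤ p^k(p−1)`, `q ∈ qⁿ·ℐ_K`, `‖q‖ = p^{−h}` ⟹ `(n−1)·h ≤ c + k − p^k/e`.
(For comparison print's edge on the same window is `c + k − 1/e`, `CandInternal2RealLabels` with `LogRadiusClosedForm.logRadiusB_eq_of_window`.)
[claim: Mochizuki2012, status: disputed] -/
theorem height_le_sharp_of_window {k : ℕ} (hk : 1 ≤ k) (hlo : p ^ (k - 1) * (p - 1) < absRamificationIdx p K)
    (hhi : absRamificationIdx p K ≤ p ^ k * (p - 1))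
    {q : K} {h : ℝ} (hqh : ‖q‖ = (p : ℝ) ^ (-h)) {n : ℕ} (hmem : q ∈ q ^ n • logShell (PadicLogOnUnits.ofUnitLog p K)) :
    ((n : ℝ) - 1) * h ≤ ((if p = 2 then 2 else 1 : ℕ) : ℝ) + k - (p : ℝ) ^ k / (absRamificationIdx p K : ℝ) :=
  have hw := turning_of_window p hk hlo hhi
  height_le_of_mem_pow_smul_logShell_sharp p K hw.1 hw.2 hqh hmem

/-- **DECIDED-NEG by integer window**: `k ≥ 1`, `p^{k−1}(p−1) < e ≤ p^k(p−1)`, `c + k − p^k/e < (n−1)·h` ⟹ `q ∉ qⁿ·ℐ_K`.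
[claim: Mochizuki2012, status: disputed] -/
theorem not_mem_of_lt_sharp_of_window {k : ℕ} (hk : 1 ≤ k) (hlo : p ^ (k - 1) * (p - 1) < absRamificationIdx p K)
    (hhi : absRamificationIdx p K ≤ p ^ k * (p - 1))
    {q : K} {h : ℝ} (hqh : ‖q‖ = (p : ℝ) ^ (-h)) {n : ℕ}
    (hlt : ((if p = 2 then 2 else 1 : ℕ) : ℝ) + k - (p : ℝ) ^ k / (absRamificationIdx p K : ℝ) < ((n : ℝ) - 1) * h) :
    q ∉ q ^ n • logShell (PadicLogOnUnits.ofUnitLog p K) :=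
  have hw := turning_of_window p hk hlo hhi
  not_mem_of_lt_sharp p K hw.1 hw.2 hqh hlt

/-- **SHARP EDGE for `e ≤ p − 1`**: `q ∈ qⁿ·ℐ_K`, `‖q‖ = p^{−h}` ⟹ `(n−1)·h ≤ c − 1/e`. At the boundary `e = p − 1` this is `1 − 1/e` for odd
`p` (print's edge there: `2 − 1/e`); on the tame range `e ≤ p − 2` it coincides with print's (`b_e = −1/e`). [claim: Mochizuki2012, status: disputed] -/
theorem height_le_sharp_of_le_sub_one (he : absRamificationIdx p K ≤ p - 1)
    {q : K} {h : ℝ} (hqh : ‖q‖ = (p : ℝ) ^ (-h)) {n : ℕ} (hmem : q ∈ q ^ n • logShell (PadicLogOnUnits.ofUnitLog p K)) :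
    ((n : ℝ) - 1) * h ≤ ((if p = 2 then 2 else 1 : ℕ) : ℝ) - 1 / (absRamificationIdx p K : ℝ) := by
  have hw := turning_zero_of_le p he
  have h0 := height_le_of_mem_pow_smul_logShell_sharp p K hw.1 hw.2 hqh hmem
  simpa using h0

/-- **DECIDED-NEG for `e ≤ p − 1`**: `c − 1/e < (n−1)·h ⟹ q ∉ qⁿ·ℐ_K`. [claim: Mochizuki2012, status: disputed] -/
theorem not_mem_of_lt_sharp_of_le_sub_one (he : absRamificationIdx p K ≤ p - 1)
    {q : K} {h : ℝ} (hqh : ‖q‖ = (p : ℝ) ^ (-h)) {n : ℕ}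
    (hlt : ((if p = 2 then 2 else 1 : ℕ) : ℝ) - 1 / (absRamificationIdx p K : ℝ) < ((n : ℝ) - 1) * h) :
    q ∉ q ^ n • logShell (PadicLogOnUnits.ofUnitLog p K) :=
  fun hmem => (not_le.2 hlt) (height_le_sharp_of_le_sub_one p K he hqh hmem)

/-- **ROOT FORM by integer window**: `k ≥ 1`, `p^{k−1}(p−1) < e ≤ p^k(p−1)`, `‖q̲‖^N = p^{−H}`, `q̲ ∈ q̲ⁿ·ℐ_K` ⟹
`(n−1)·H ≤ N·(c + k − p^k/e)`. [claim: Mochizuki2012, status: disputed] -/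
theorem root_height_le_sharp_of_window {k : ℕ} (hk : 1 ≤ k) (hlo : p ^ (k - 1) * (p - 1) < absRamificationIdx p K)
    (hhi : absRamificationIdx p K ≤ p ^ k * (p - 1))
    {q : K} {N : ℕ} (hN : 0 < N) {H : ℝ} (hqN : ‖q‖ ^ N = (p : ℝ) ^ (-H)) {n : ℕ}
    (hmem : q ∈ q ^ n • logShell (PadicLogOnUnits.ofUnitLog p K)) :
    ((n : ℝ) - 1) * H ≤ N * (((if p = 2 then 2 else 1 : ℕ) : ℝ) + k - (p : ℝ) ^ k / (absRamificationIdx p K : ℝ)) :=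
  have hw := turning_of_window p hk hlo hhi
  root_height_le_of_mem_pow_smul_logShell_sharp p K hw.1 hw.2 hN hqN hmem

/-! ## §4. The sharp edge never loses a cell: `κ⁺♯ ≤ κ⁺` -/

/-- **`a₀ ≤ ⌊log_p(p·e/(p−1))⌋`**: the turning point is at most print's floor (from `p^{a₀−1}(p−1) < e` one gets `p^{a₀} < p·e/(p−1)`).
[cite: Mochizuki2012, IUTchIV Prop. 1.2 p. 10] -/
theorem turning_le_floor {e a₀ : ℕ} (he : 1 ≤ e)
    (hlo : ∀ a < a₀, (1 : ℤ) * (p : ℤ) ^ a * ((p : ℤ) - 1) < e) :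
    (a₀ : ℤ) ≤ ⌊Real.log ((p : ℝ) * e / ((p : ℝ) - 1)) / Real.log p⌋ := by
  have hp := (Fact.out : p.Prime).one_lt
  have hp1 : (1 : ℝ) < p := by exact_mod_cast hp
  have hp0 : (0 : ℝ) < p := by linarith
  have hp1' : (0 : ℝ) < (p : ℝ) - 1 := by linarith
  have he' : (0 : ℝ) < e := by exact_mod_cast he
  have hx0 : 0 < (p : ℝ) * e / ((p : ℝ) - 1) := div_pos (mul_pos hp0 he') hp1'
  rw [Real.log_div_log, Int.le_floor, Int.cast_natCast, Real.le_logb_iff_rpow_le hp1 hx0, Real.rpow_natCast,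
    le_div_iff₀ hp1']
  -- goal: p^a₀ * (p - 1) ≤ p * e
  rcases Nat.eq_zero_or_pos a₀ with h0 | hpos
  · subst h0
    simp only [pow_zero, one_mul]
    have : (1 : ℝ) ≤ e := by exact_mod_cast he
    nlinarith
  · have h := hlo (a₀ - 1) (by omega)
    have h' : (p : ℝ) ^ (a₀ - 1) * ((p : ℝ) - 1) < e := by
      have : ((1 : ℤ) * (p : ℤ) ^ (a₀ - 1) * ((p : ℤ) - 1) : ℝ) < ((e : ℤ) : ℝ) := by exact_mod_cast h
      push_cast at this
      linarith
    have hk1 : a₀ = (a₀ - 1) + 1 := by omega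
    calc (p : ℝ) ^ a₀ * ((p : ℝ) - 1) = p * ((p : ℝ) ^ (a₀ - 1) * ((p : ℝ) - 1)) := by
          conv_lhs => rw [hk1, pow_succ]
          ring
      _ ≤ p * e := by nlinarith

/-- **THE SHARP EDGE NEVER EXCEEDS PRINT'S**: `c + a₀ − p^{a₀}/e ≤ b_e + c` (`a₀ ≤ ⌊log_p(p·e/(p−1))⌋`, `p^{a₀} ≥ 1`): every cell decided
NEG by `CandInternal2RealLabels.height_le_of_mem_pow_smul_logShell` is decided NEG here. [cite: Mochizuki2012, IUTchIV Prop. 1.2 p. 10] -/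
theorem sharp_le_print {e a₀ : ℕ} (he : 1 ≤ e)
    (hlo : ∀ a < a₀, (1 : ℤ) * (p : ℤ) ^ a * ((p : ℤ) - 1) < e) (c : ℝ) :
    c + a₀ - (p : ℝ) ^ a₀ / (e : ℝ) ≤ logRadiusB p e + c := by
  have hfl := turning_le_floor p he hlo
  have hfl' : (a₀ : ℝ) ≤ (⌊Real.log ((p : ℝ) * e / ((p : ℝ) - 1)) / Real.log p⌋ : ℝ) := by exact_mod_cast hfl
  have he' : (0 : ℝ) < e := by exact_mod_cast he
  have hp1 : (1 : ℝ) ≤ p := by exact_mod_cast (Fact.out : p.Prime).one_lt.le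
  have hpow : (1 : ℝ) ≤ (p : ℝ) ^ a₀ := one_le_pow₀ hp1
  have hdiv : 1 / (e : ℝ) ≤ (p : ℝ) ^ a₀ / e := div_le_div_of_nonneg_right hpow he'.le
  rw [logRadiusB]
  linarith

/-- … at a field: `κ⁺♯ ≤ κ⁺` for the real log-shell of `K`. [cite: Mochizuki2012, IUTchIV Prop. 1.2 p. 10] -/
theorem sharp_le_print_field {a₀ : ℕ}
    (hlo : ∀ a < a₀, (1 : ℤ) * (p : ℤ) ^ a * ((p : ℤ) - 1) < absRamificationIdx p K) :
    ((if p = 2 then 2 else 1 : ℕ) : ℝ) + a₀ - (p : ℝ) ^ a₀ / (absRamificationIdx p K : ℝ) ≤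
      logRadiusB p (absRamificationIdx p K) + ((if p = 2 then 2 else 1 : ℕ) : ℝ) :=
  sharp_le_print p (absRamificationIdx_pos p K) hlo _

/-! ## §5. Worked edges (arithmetic only; `c = 1` for odd `p`) -/

/-- `(p, e) = (5, 7)`: window `k = 1` (`4 < 7 ≤ 20`), `κ⁺♯ = 1 + 1 − 5/7 = 9/7` (print: `b + c = 6/7 + 1 = 13/7`). -/
example : (1 : ℝ) + 1 - (5 : ℝ) ^ 1 / 7 = 9 / 7 := by norm_num

/-- `(p, e) = (3, 10)`: window `k = 2` (`6 < 10 ≤ 18`), `κ⁺♯ = 1 + 2 − 9/10 = 21/10` (print: `⌊log₃ 15⌋ − 1/10 + 1 = 29/10`). -/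
example : (1 : ℝ) + 2 - (3 : ℝ) ^ 2 / 10 = 21 / 10 := by norm_num

end Summit.ABC.IUTFork.Repair.CandInternal2RealSharp

end
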